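import Literature.MathematicalPhysics.QuantumFieldTheory.Balaban1983to89.Beta.RemainderHasMajG1kTower
import Literature.MathematicalPhysics.QuantumFieldTheory.Balaban1983to89.Beta.RemainderOriginTower

/-!
# T. Bałaban, *The variational problem and background fields in renormalization group method for lattice gauge theories*, Commun. Math.
# Phys. **102** (1985) 277–309 [Balaban1985Variational] (182) p. 307, (190) p. 308, (129) p. 297, p. 306 after (179), with [Balaban1985BackgroundPropagators]
# Thm 3.3 (3.42) pp. 397–399, (3.126) p. 420, (3.132)–(3.133) p. 422, (3.137) p. 423: **NODE D OF ROW (D4) AT THE ORIGIN IN A BACKGROUND ON NE9's TOWER — THE END: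
# `∃ (α⋆, B, δ, A′, r₁)` BEFORE THE HEIGHT, THE PERIOD AND THE BACKGROUND, EVERY LETTER OF V79 A TREE THEOREM BY NAME on the cell's MODEL — the (190) letter of
# `H₀ + G̃Δ⁽²⁾H₀`, `H₀ = H₁,k(U)`, modulo `Δ⁽²⁾`'s displayed local majorant and the two smallnesses in `λ`**

CITATION HEADER (lean-in-tree rule 2026-08-18).  Sources: [Balaban1985Variational] (B11 = [15]; held `paper:balaban1985-cmp102-variational-background`, journal page =
PDF page + 276): (129) p. 297 (*«For the operator Δ_a⁻¹ = G we have proved Theorem 3.3 in [5], and especially the bounds (3.42)»*), (131) p. 298, p. 306 after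
(179) (the new `G = (Δ_a − Δ⁽²⁾)⁻¹` *«has exactly the same properties as Δ_a⁻¹»*), (180) p. 306, (182) p. 307, (190) p. 308, (45) p. 285, (110) p. 294;
[Balaban1985BackgroundPropagators] (B9 = [5]; `paper:balaban1985-cmp99-background-propagators`, journal page = PDF page + 388): Thm 3.1 (3.42) p. 397, Thm 3.3
p. 399, (3.15)–(3.16) p. 393, (3.26) p. 395, Thm 3.11 p. 416, (3.126) p. 420, (3.132)–(3.133) p. 422, (3.137)–(3.138) p. 423; [Balaban1984PropagatorsII] (B6)
(2.51)–(2.52) p. 232, (2.54) p. 233, Lemma 2.1 (2.61) p. 234.  [15] pp. 297, 306–308 and [5] pp. 420–423 re-read this generation in the held text layers; the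
other loci as printed in the headers of the tree files consumed.

WHY THIS FILE (audit cell `pub-balaban`, BINDER row (D4), OWNER lineage `b2b-balaban-beta-an4`, gen 111; the END of the capstone of memo `FLAT-LETTERS-LOCATED.md`
§21 (v)).  «Y5b» `Beta.RemainderOriginTower.exists_ineq190_origin_tower_sup` is V79 on NE9's tower at ONE height with the two analytic letters `hG0`, `hInv₀`
and the row sum displayed.  All three are now tree theorems with their constants BEFORE the height: `hG0` = «Y4d»
`Beta.RemainderHasMajG1kTower.exists_hasMaj_G1k_tower_sup` (the NE9 crew's END (K64) `B9Eq326G1kSupRowClosed.exists_local_letter_G1k` in the (190) currency: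
`∃ (α₁, B, δ)`), `hInv₀` = «Y4a» `Beta.RemainderHasMajQG1QInvTowerClosed.exists_hasMaj_Kinv_tower_sup` ((FCLK): `∃ (α₀, r₁, A′)`), the row sum (2.61) on the
torus of blocks at any rate `σ > 0` with the constant `c₀(1, σ)^d` (`B9Thm37GlueTorus.torusSum_tdist1_le`, uniform in the period).  THIS FILE composes them:
* **`exists_ineq190_origin_tower`** — `∃ α⋆ B δ A′ r₁, 0 < α⋆ ∧ 0 ≤ B ∧ 0 < δ ∧ 0 ≤ A′ ∧ 0 < r₁ ∧ ∀ ⟨the UNION of (K64)'s and (FCLK)'s blocks: n η (ηL^{n+1} = 1)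
  c₀ c₁ (c₀(L^{n+1})^d = c₁) (|η|^d∕c₀ ≤ ρ_w) m (1 ≤ m_i) U αU hα0 hα1 hαL hU1 hreg εU hεU hUε hLb α (0 ≤ α ≤ α⋆) hUst hUb hUη hpl hUgrad hRlev hεg hAQ hpos′
  hpos⟩ (η₀ L₀ M₀ R) (H) (ρ σ : rates with σ > 0, ρ ≥ 0, ρ + 5σ ≤ δ∕d, ρ + 5σ ≤ r₁∕d) (c := c₀(1,σ)^d) ⟨Δ⁽²⁾ displayed: D2, K_D, λ, r_D⟩ ⟨the derived constants
  bound to their closed forms, the two smallnesses q < 1, q_I < 1⟩, ∃ G′ Inv′, G′(Δ_{a,k} − Δ⁽²⁾)ᵉ = 1 = (Δ_{a,k} − Δ⁽²⁾)ᵉG′ ∧ Inv′(Q_kᵉG′Q_k†ᵉ) = 1 =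
  (Q_kᵉG′Q_k†ᵉ)Inv′ ∧ ∀ δ′, δ′∕8 ≤ ρ → Ineq190 S^{coarse}_m S^{fine}_m (H₀ + G̃Δ⁽²⁾H₀) (A₀ + B_G̃θ_Dc) δ′`, `H₀ = (G₁,kQ_k†(Q_kG₁,kQ_k†)⁻¹)ᵉ↾ℝ` = NE9's
  `H1k` BY NAME — `α⋆ := min(α₁, α₀)`; «Y5b» applied with «Y4d» ∕ «Y4a» at the height and the free row sum.
* **`exists_hasMaj_H1k_tower`** — the `Δ⁽²⁾`-free half with NO displayed analytic letter and NO smallness: [5] (3.133), first entry, for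
  `H₁,k(U) = G₁,kQ_k†(Q_kG₁,kQ_k†)⁻¹` in the (190) sup currency, `∃ (α⋆, B, δ, A′, r₁)` first — «Y5a» `hasMaj_H1_tower_sup` with «Y4d», «Y4a» and the free
  row sum: `HasMaj S^{coarse}_m S^{fine}_m (H₁,kᵉ↾ℝ) (B·(M†eK_d(1))·e^{δ}·A′·c₀(1,σ)^d·e^{−ρd})` for `σ > 0`, `0 ≤ ρ ≤ r₁∕d`, `ρ + σ ≤ δ∕d`.
READING.  After this file NODE D at the origin in a background on `Ω_k = T_η` (NE9's tower; [15]'s variational problem with only the top average constrained) is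
a tree theorem with `∃`-first constants modulo EXACTLY: (i) `hD2` — the (3.137) local majorant of `Δ⁽²⁾` on NE9's carriers (NODE-O-class identification of
[5] (3.134)'s operator; `Δ⁽²⁾ = 0`, `λ = 0` at `U = 1`); (ii) the two smallnesses `q, q_I < 1`, linear in `λ`; (iii) the cell's MODEL letters under the `∀`
(«NE9 ⇐ the named binders»: positivity `hpos` ∕ `hpos′` of [5] Thm 3.11, the bond-gradient datum, contractive transporters, the summable
regime `A_Q`); then the carrier plumbing into `Data190` (memo §9 R7) and the multi-level `{Ω_j}` case (NODE O ∕ A, FROZEN (0)).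

HONEST SCOPE.  [folklore] composition BY NAME (two `obtain`s, one `min`, the free row sum, twice); NO estimate of [5] or [15] is proved here; constants are the cell's
crude ones; nothing identifies Bałaban's step-`k` objects with tree terms beyond NE9's tower.  Row (D4) class UNCHANGED (instance 0∕1; D4 DISCHARGE NO DATE);
NOT B12 Thm 2, NOT BetaPertH, NOT continuum, NOT Clay.  HONEST DEPENDENCY (cell line): continuum YM on T⁴ ⇐ BetaPertH ∧ nine spine estimates (0/9 proved);
BetaPertH ⇐ (D1) ∧ (D4) ∧ CAP+tail; G-an2-4 gates asym, D1 and NE2/3/4.  NEW file importing «Y4d» `Beta.RemainderHasMajG1kTower` (behind (K64)) and «Y5b»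
`Beta.RemainderOriginTower`; nothing modified; 0 `def`; standard axioms; no `sorry`.  Net new unproved facts: 0.
-/

noncomputable section

open scoped BigOperators InnerProductSpace ComplexConjugate

namespace Literature.MathematicalPhysics.QuantumFieldTheory.Balaban1983to89.Beta.RemainderOriginTowerClosed

open B11SectG B11SupSize190
open B4Sect5Torus (TSite tdist tdist_nonneg)
open B4Sect5Proof (latticeConst)
open B5TorusCover (UT)
open B9Thm34Ext (toB6)
open B9Thm37GlueTorus (torusGeom tdist1 torusSum_tdist1_le)
open B9SectCLatticeCarrier (Bond bpos unshift)
open B9Eq311L2Pairing (WL2)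
open B9Eq319QprimeTorus (blockCoord)
open B9Eq315QTower (towerP UlevOf)
open B9Eq315QTorus (perCfg cornerSite)
open B9Eq316TowerFlatIsOneStep (siteCast towerP_eq_fineP_pow)
open B7Prop1Explicit (U1 Wcx boxVec)
open B9Eq310DeltaPrime (plaqHolU)
open B9Eq310HessianOperator (adTransportW)
open B11Eq103H1Complex (SiteL2K BondL2K KinvLatticeK)
open B9Eq326OperatorTower (laplaceAk QkW G1k H1k)
open B9Eq324DeltaPrimeATower (laplacePrimeAk)
open Beta.RemainderHasMajG1kTower (exists_hasMaj_G1k_tower_sup)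
open Beta.RemainderHasMajQG1QInvTowerClosed (exists_hasMaj_Kinv_tower_sup)
open Beta.RemainderOriginTower (exists_ineq190_origin_tower_sup)
open Beta.RemainderHasMajH1kTower (hasMaj_H1_tower_sup)

/-! ### The free row sum on the torus of blocks (private) -/

section Aux

variable {d : ℕ} {m : Fin d → ℕ} [∀ i, NeZero (m i)]

/-- The row sum (2.61) on the torus of blocks at any rate `σ > 0`: constant `c₀(1, σ)^d`, uniform in the period. [folklore]
[cite: Balaban1984PropagatorsII, Lemma 2.1 (2.61) p.234] -/
private theorem rowSum_blocks (η₀ L₀ M₀ R : ℝ) (H : Prop) {σ : ℝ} (hσ : 0 < σ) :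
    RowSum (toB6 (torusGeom m η₀ L₀ M₀) R H) σ (B6.c0 1 σ ^ d) := by
  intro y
  have h := torusSum_tdist1_le (N := m) y (δ₀ := 1) (α := σ) (by rw [mul_one]; exact hσ)
  show ∑ y' : UT m, Real.exp (-(σ * tdist1 m y y')) ≤ _
  simpa only [mul_one] using h

end Aux

/-! ## THE END: NODE D at the origin in a background on NE9's tower, `∃`-first -/

section Tower

variable {d : ℕ} (hd : 1 ≤ d) (L : ℕ) [NeZero L] (hL : 1 ≤ L) (hL3 : 3 ≤ L)
  {𝔸 : Type*} [NormedRing 𝔸] [NormedAlgebra ℂ 𝔸] [CompleteSpace 𝔸] [NormOneClass 𝔸] [StarRing 𝔸] [NormedStarGroup 𝔸] [StarModule ℂ 𝔸]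
  {W : Type} [NormedAddCommGroup W] [InnerProductSpace ℂ W] [FiniteDimensional ℂ W] (φ : W ≃ₗ[ℂ] 𝔸)
  {Mφ Mφ' : ℝ} (hMφ : 0 ≤ Mφ) (hMφ' : 0 ≤ Mφ') (hφ : ∀ w, ‖φ w‖ ≤ Mφ * ‖w‖) (hφ' : ∀ X, ‖φ.symm X‖ ≤ Mφ' * ‖X‖) (hstar : ∀ X : 𝔸, ‖star X‖ ≤ ‖X‖)
  {a : ℝ} (ha : 0 < a) {a' : ℝ} (ha' : 0 < a') {ϱ : ℝ} (hϱ0 : 0 ≤ ϱ) (hϱ1 : ϱ < 1)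
  (τ : 𝔸 →ₗ[ℂ] ℂ) {Cτ : ℝ} (hτ : ∀ X, ‖τ X‖ ≤ Cτ * ‖X‖) (hCτ : 0 ≤ Cτ) {Mτ : ℝ} (hτm : ∀ X Y : 𝔸, ‖τ (X * Y)‖ ≤ Mτ * ‖X‖ * ‖Y‖) (hMτ : 0 ≤ Mτ)
  {ρw : ℝ} (hρw : 0 ≤ ρw)
  (hτ₁ : ∀ X : 𝔸, τ (star X) = conj (τ X)) (hτ₂ : ∀ X Y : 𝔸, τ (X * Y) = τ (Y * X)) (hφτ : ∀ X Y : 𝔸, ⟪φ.symm X, φ.symm Y⟫_ℂ = τ (star X * Y))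
  (AQ : ℝ)

include hd hL hL3 hMφ hMφ' hφ hφ' hstar ha ha' hϱ0 hϱ1 hτ hCτ hτm hMτ hρw hτ₁ hτ₂ hφτ in
/-- **[5] (3.133), FIRST ENTRY, FOR `H₁,k(U) = G₁,kQ_k†(Q_kG₁,kQ_k†)⁻¹` ON NE9's TOWER IN THE (190) SUP CURRENCY — `∃ (α⋆, B, δ, A′, r₁)` FIRST, NO DISPLAYED
ANALYTIC LETTER** ([5] p. 423: *«From (3.129) and (3.132) with G₁ instead of G we get the inequalities (3.133) for H₁»*; [15] (129)).  «Y5a»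
`Beta.RemainderHasMajH1kTower.hasMaj_H1_tower_sup` with `hG0` := «Y4d» (= the NE9 END (K64)), `hInv₀` := «Y4a» ((FCLK)) and the row sum free on the torus of
blocks: for every height, period, background in the window `α ≤ α⋆ = min(α₁, α₀)` (the cell's MODEL letters under the `∀`, as in `exists_ineq190_origin_tower`),
every geometry and all rates `ρ ≥ 0`, `σ > 0` with `ρ ≤ r₁∕d`, `ρ + σ ≤ δ∕d`:
`HasMaj S^{coarse}_m S^{fine}_m (H₁,k(U)ᵉ↾ℝ) (B·(M†eK_d(1))·e^{δ}·A′·c₀(1,σ)^d·e^{−ρ·d})` with `H₁,k(U) = B9Eq326OperatorTower.H1k … hαL hpos` LITERALLY (`Q_k` onto discharged by `QkW_surjective`), `M† = M_φ′e^{100d(d+1)L^dA_Q}M_φ·2d` — the `hH0`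
letter of NODE D ((3.133) for `H₀ = H₁,k`) as a tree theorem on `Ω_k = T_η`, the case `Δ⁽²⁾ = 0` of the END needing no smallness (cf. the NE9 cell's
POINTWISE form of the same row, ne9-leaf-05's (K65) `B9Eq3126H1kSupRowClosed.exists_local_letter_H1k`, composed on the NE9 side from its abstract `H₁` assembly
(K63); this corollary composes on the (D4) side through V79's `Beta.RemainderOriginBaseLetters.hasMaj_H0_of_base_letters` and lands in the socket's currency).
[cite: Balaban1985BackgroundPropagators, (3.126) p.420, (3.132)–(3.133) p.422, p.423, Thm 3.3 (3.42) p.397+p.399, Thm 3.11 p.416] [cite: Balaban1985Variational, (129) p.297, (190) p.308]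
[cite: Balaban1984PropagatorsII, (2.51)–(2.52) p.232, (2.54) p.233, Lemma 2.1 (2.61) p.234] -/
theorem exists_hasMaj_H1k_tower :
    ∃ αs B δ A' r₁ : ℝ, 0 < αs ∧ 0 ≤ B ∧ 0 < δ ∧ 0 ≤ A' ∧ 0 < r₁ ∧
      ∀ (n : ℕ) (η : ℝ) (_hηL : η * (L : ℝ) ^ (n + 1) = 1) (c₀ c₁ : ℝ) [Fact (0 < c₀)] [Fact (0 < c₁)]
        (_hw : c₀ * ((L : ℝ) ^ (n + 1)) ^ d = c₁) (_hρ : |η| ^ d / c₀ ≤ ρw) (m : Fin d → ℕ) [∀ i, NeZero (m i)] (_hm : ∀ i, 1 ≤ m i)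
        (U : Bond d (towerP L m (n + 1)) → 𝔸ˣ) (αU : ℕ → ℝ) (_hα0 : ∀ j, 0 ≤ αU j) (hα1 : ∀ j, αU j ≤ 1 / 64)
        (_hαL : ∀ j, 50 * (d + 1) * αU j * (L : ℝ) ^ d ≤ 1 / 2)
        (hU1 : ∀ (j : ℕ) (x : B7Prop1Explicit.Site d) (k : Fin d), perCfg (towerP L m (j + 1)) (UlevOf L m (n + 1) U j) x k ∈ U1 𝔸)
        (hreg : ∀ (j : ℕ) (y : TSite d (towerP L m j)) (k : Fin d) (ρ' : Fin d → Fin L),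
          ‖((Wcx L (perCfg (towerP L m (j + 1)) (UlevOf L m (n + 1) U j)) (cornerSite L y) k (boxVec L ρ') : 𝔸ˣ) : 𝔸) - 1‖ ≤ αU j)
        (εU : ℕ → ℝ) (_hεU : ∀ j, 0 ≤ εU j) (_hUε : ∀ (j : ℕ) (b : Bond d (towerP L m (j + 1))), ‖(UlevOf L m (n + 1) U j b : 𝔸) - 1‖ ≤ εU j)
        (_hLb : ∀ (j : ℕ) (b : Bond d (towerP L m (j + 1))), UlevOf L m (n + 1) U j b ∈ U1 𝔸)
        (α : ℝ) (_hα : 0 ≤ α) (_hαle : α ≤ αs)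
        (hUst : ∀ b, star (U b : 𝔸) = (((U b)⁻¹ : 𝔸ˣ) : 𝔸)) (_hUb : ∀ b, U b ∈ U1 𝔸) (_hUη : ∀ b, ‖(U b : 𝔸) - 1‖ ≤ α * η)
        (_hpl : ∀ p : B9SectCLatticeCarrier.Plaq d (towerP L m (n + 1)), ‖(plaqHolU U p : 𝔸) - 1‖ ≤ α * η ^ 2)
        (_hUgrad : ∀ (x : TSite d (towerP L m (n + 1))) (μ : Fin d), ‖(U (x, μ) : 𝔸) - U (unshift μ x, μ)‖ ≤ α * η ^ 2)
        (_hRlev : ∀ (j : ℕ) (b : Bond d (towerP L m (j + 1))) (w : W), ‖adTransportW φ (UlevOf L m (n + 1) U j) b w‖ ≤ ‖w‖)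
        (_hεg : ∀ j < n + 1, εU j ≤ α * ϱ ^ j) (_hAQ : ∑ j ∈ Finset.range (n + 1), αU j ≤ AQ)
        (hpos' : ∀ x : SiteL2K ℂ d (towerP L m (n + 1)) c₀ W, x ≠ 0 → 0 < RCLike.re ⟪x, laplacePrimeAk L m n φ η U a' (c₁ := c₁) x⟫_ℂ)
        (hpos : ∀ x : BondL2K ℂ d (towerP L m (n + 1)) c₀ W, x ≠ 0 →
          0 < RCLike.re ⟪x, laplaceAk L m n φ η U hL αU hα1 hU1 hreg τ (c₀ := c₀) (c₁ := c₁) a x⟫_ℂ)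
        (η₀ L₀ M₀ R : ℝ) (H : Prop)
        (ρ σ : ℝ) (_hσ : 0 < σ) (_hρ0 : 0 ≤ ρ) (_hρI : ρ ≤ r₁ / d) (_hρ₁ : ρ + σ ≤ δ / d),
        HasMaj
          (supSize (toB6 (torusGeom m η₀ L₀ M₀) R H)
            (fun y => Finset.univ.filter fun c : Bond d m => bpos c = UT.toSite m y)
            (fun c => UT.ofSite m (bpos c)) : BlockNorm (toB6 (torusGeom m η₀ L₀ M₀) R H) (Bond d m → W))
          (supSize (toB6 (torusGeom m η₀ L₀ M₀) R H)
            (fun y => Finset.univ.filter fun b : Bond d (towerP L m (n + 1)) =>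
              blockCoord (L ^ (n + 1)) m (siteCast (towerP_eq_fineP_pow L m (n + 1)) (bpos b)) = UT.toSite m y)
            (fun b => UT.ofSite m (blockCoord (L ^ (n + 1)) m (siteCast (towerP_eq_fineP_pow L m (n + 1)) (bpos b)))) :
              BlockNorm (toB6 (torusGeom m η₀ L₀ M₀) R H) (Bond d (towerP L m (n + 1)) → W))
          (((WL2.linearEquiv ℂ ℂ (fun _ : Bond d (towerP L m (n + 1)) => c₀) :
                BondL2K ℂ d (towerP L m (n + 1)) c₀ W ≃ₗ[ℂ] (Bond d (towerP L m (n + 1)) → W)).toLinearMap ∘ₗ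
              H1k L m n φ η U hL αU hα1 hU1 hreg τ (c₀ := c₀) (c₁ := c₁) _hαL hpos ∘ₗ
              (WL2.linearEquiv ℂ ℂ (fun _ : Bond d m => c₁) : BondL2K ℂ d m c₁ W ≃ₗ[ℂ] (Bond d m → W)).symm.toLinearMap).restrictScalars ℝ)
          (fun y v => B * ((Mφ' * Real.exp (100 * d * (d + 1) * (L : ℝ) ^ d * AQ) * Mφ * ((2 * d : ℕ) : ℝ)) * Real.exp 1 *
              latticeConst d 1) * Real.exp δ * A' * (B6.c0 1 σ ^ d) *
            Real.exp (-(ρ * (toB6 (torusGeom m η₀ L₀ M₀) R H).dist y v))) := by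
  obtain ⟨α₁, B, δ, hα₁, hB, hδ, HG⟩ := exists_hasMaj_G1k_tower_sup hd L hL hL3 φ hMφ hMφ' hφ hφ' hstar ha ha' hϱ0 hϱ1 τ hτ hCτ hτm hMτ hρw
    hτ₁ hτ₂ hφτ AQ
  obtain ⟨α₀, r₁, A', hα₀, hr₁, hA', HI⟩ := exists_hasMaj_Kinv_tower_sup hd L hL hL3 φ hMφ hMφ' hφ hφ' hstar ha ha' hϱ0 hϱ1 τ hτ hCτ hτm hMτ hρw
    hτ₁ hτ₂ hφτ
  refine ⟨min α₁ α₀, B, δ, A', r₁, lt_min hα₁ hα₀, hB, hδ, hA', hr₁, ?_⟩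
  intro n η hηL c₀ c₁ _ _ hw hρ m _ hm U αU hα0 hα1 hαL hU1 hreg εU hεU hUε hLb α hα hαle hUst hUb hUη hpl hUgrad hRlev hεg hAQ hpos' hpos
    η₀ L₀ M₀ R H ρ σ hσ hρ0 hρI hρ₁
  have hG0 := HG n η hηL c₀ c₁ hw hρ m hm U αU hα0 hα1 hU1 hreg εU hεU hUε hLb α hα (hαle.trans (min_le_left _ _)) hUst hUb hUη hpl hUgrad
    hRlev hεg hAQ hpos' hpos η₀ L₀ M₀ R H
  have hQ := B9Eq326OperatorTower.QkW_surjective L m n φ U hL αU hα1 hU1 hreg (c₀ := c₀) (c₁ := c₁) hαL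
  have hInv0 := HI n η hηL c₀ c₁ hw hρ m hm U αU hα0 hα1 hαL hU1 hreg εU hεU hUε hLb α hα (hαle.trans (min_le_right _ _)) hUst hUb hUη hpl
    hεg hpos hQ η₀ L₀ M₀ R H
  exact hasMaj_H1_tower_sup L m n φ η U hL αU hα0 hα1 hU1 hreg hMφ hφ hMφ' hφ' τ hpos hQ η₀ L₀ M₀ R H hd hm hw hAQ hB hδ.le hA' hr₁.le
    (rowSum_blocks η₀ L₀ M₀ R H hσ) hσ.le hρ0 hρI hρ₁ hG0 hInv0

include hd hL hL3 hMφ hMφ' hφ hφ' hstar ha ha' hϱ0 hϱ1 hτ hCτ hτm hMτ hρw hτ₁ hτ₂ hφτ in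
/-- **NODE D OF ROW (D4) AT THE ORIGIN IN A BACKGROUND ON NE9's TOWER — THE END, `∃ (α⋆, B, δ, A′, r₁)` FIRST** ([15] (182): `(δ/δB)𝓗(0) = H₀ + G̃Δ⁽²⁾H₀`;
(190)).  «Y5b» `Beta.RemainderOriginTower.exists_ineq190_origin_tower_sup` with its two analytic letters DISCHARGED ∃-first — `hG0` by «Y4d»
`exists_hasMaj_G1k_tower_sup` (= the NE9 END (K64): `∃ (α₁, B, δ)`), `hInv₀` by «Y4a» `exists_hasMaj_Kinv_tower_sup` ((FCLK): `∃ (α₀, r₁, A′)`) — and the row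
sum (2.61) FREE on the torus of blocks (`c = c₀(1,σ)^d`, `B9Thm37GlueTorus.torusSum_tdist1_le`); `α⋆ = min(α₁, α₀)`.  Under the `∀`: the UNION of (K64)'s and
(FCLK)'s data blocks (the cell's MODEL letters: window `α ≤ α⋆` on bonds, plaquettes, bond gradients; level averages `U1`-valued with display `αU`, `hαL`, the
summable regime `Σ_{j<n+1} αU_j ≤ A_Q`; contractive transporters; positivity `hpos′`, `hpos` ([5] Thm 3.11) DISPLAYED; `Q_k` onto from `hαL`), the rates `ρ ≥ 0`,
`σ > 0` with `ρ + 5σ ≤ δ∕d`, `ρ + 5σ ≤ r₁∕d`, the row-sum constant bound to `c₀(1,σ)^d`, `Δ⁽²⁾` DISPLAYED with its local majorant ((3.137); NODE-O-class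
identification NOT done), the derived constants bound to their closed forms (`rfl`) and the two smallnesses `q, q_I < 1` in `λ`.  CONCLUSION: «Y5b»'s — `G′`,
`(Q_kG′Q_k†)⁻¹` CONSTRUCTED (two-sided) and `∀ δ′, δ′∕8 ≤ ρ → Ineq190 S^{coarse}_m S^{fine}_m (H₀ + G̃Δ⁽²⁾H₀) (A₀ + B_G̃θ_Dc) δ′`, `H₀ = (B9Eq326OperatorTower.H1k … hαL hpos)ᵉ↾ℝ`
LITERALLY (`Q_k` onto discharged by `QkW_surjective … hαL`; «Y5b»'s `hQ`-general composite agrees by `H1LatticeK_eq`).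
[cite: Balaban1985Variational, (182) p.307, (190) p.308, (129)–(131) pp.297–298, p.306 after (179), (180) p.306; Balaban1985BackgroundPropagators, Thm 3.1 (3.42) p.397, Thm 3.3 p.399, (3.126) p.420, (3.132)–(3.133) p.422, (3.137)–(3.138) p.423, Thm 3.11 p.416; Balaban1984PropagatorsII, (2.54) p.233, Lemma 2.1 (2.61) p.234] -/
theorem exists_ineq190_origin_tower :
    ∃ αs B δ A' r₁ : ℝ, 0 < αs ∧ 0 ≤ B ∧ 0 < δ ∧ 0 ≤ A' ∧ 0 < r₁ ∧
      ∀ (n : ℕ) (η : ℝ) (_hηL : η * (L : ℝ) ^ (n + 1) = 1) (c₀ c₁ : ℝ) [Fact (0 < c₀)] [Fact (0 < c₁)]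
        (_hw : c₀ * ((L : ℝ) ^ (n + 1)) ^ d = c₁) (_hρ : |η| ^ d / c₀ ≤ ρw) (m : Fin d → ℕ) [∀ i, NeZero (m i)] (_hm : ∀ i, 1 ≤ m i)
        (U : Bond d (towerP L m (n + 1)) → 𝔸ˣ) (αU : ℕ → ℝ) (_hα0 : ∀ j, 0 ≤ αU j) (hα1 : ∀ j, αU j ≤ 1 / 64)
        (_hαL : ∀ j, 50 * (d + 1) * αU j * (L : ℝ) ^ d ≤ 1 / 2)
        (hU1 : ∀ (j : ℕ) (x : B7Prop1Explicit.Site d) (k : Fin d), perCfg (towerP L m (j + 1)) (UlevOf L m (n + 1) U j) x k ∈ U1 𝔸)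
        (hreg : ∀ (j : ℕ) (y : TSite d (towerP L m j)) (k : Fin d) (ρ' : Fin d → Fin L),
          ‖((Wcx L (perCfg (towerP L m (j + 1)) (UlevOf L m (n + 1) U j)) (cornerSite L y) k (boxVec L ρ') : 𝔸ˣ) : 𝔸) - 1‖ ≤ αU j)
        (εU : ℕ → ℝ) (_hεU : ∀ j, 0 ≤ εU j) (_hUε : ∀ (j : ℕ) (b : Bond d (towerP L m (j + 1))), ‖(UlevOf L m (n + 1) U j b : 𝔸) - 1‖ ≤ εU j)
        (_hLb : ∀ (j : ℕ) (b : Bond d (towerP L m (j + 1))), UlevOf L m (n + 1) U j b ∈ U1 𝔸)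
        (α : ℝ) (_hα : 0 ≤ α) (_hαle : α ≤ αs)
        (hUst : ∀ b, star (U b : 𝔸) = (((U b)⁻¹ : 𝔸ˣ) : 𝔸)) (_hUb : ∀ b, U b ∈ U1 𝔸) (_hUη : ∀ b, ‖(U b : 𝔸) - 1‖ ≤ α * η)
        (_hpl : ∀ p : B9SectCLatticeCarrier.Plaq d (towerP L m (n + 1)), ‖(plaqHolU U p : 𝔸) - 1‖ ≤ α * η ^ 2)
        (_hUgrad : ∀ (x : TSite d (towerP L m (n + 1))) (μ : Fin d), ‖(U (x, μ) : 𝔸) - U (unshift μ x, μ)‖ ≤ α * η ^ 2)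
        (_hRlev : ∀ (j : ℕ) (b : Bond d (towerP L m (j + 1))) (w : W), ‖adTransportW φ (UlevOf L m (n + 1) U j) b w‖ ≤ ‖w‖)
        (_hεg : ∀ j < n + 1, εU j ≤ α * ϱ ^ j) (_hAQ : ∑ j ∈ Finset.range (n + 1), αU j ≤ AQ)
        (hpos' : ∀ x : SiteL2K ℂ d (towerP L m (n + 1)) c₀ W, x ≠ 0 → 0 < RCLike.re ⟪x, laplacePrimeAk L m n φ η U a' (c₁ := c₁) x⟫_ℂ)
        (hpos : ∀ x : BondL2K ℂ d (towerP L m (n + 1)) c₀ W, x ≠ 0 →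
          0 < RCLike.re ⟪x, laplaceAk L m n φ η U hL αU hα1 hU1 hreg τ (c₀ := c₀) (c₁ := c₁) a x⟫_ℂ)
        (η₀ L₀ M₀ R : ℝ) (H : Prop)
        -- the rates and the (free) row-sum constant
        (ρ σ c : ℝ) (_hσ : 0 < σ) (_hρ0 : 0 ≤ ρ) (_hρ₁ : ρ + 5 * σ ≤ δ / d) (_hρI : ρ + 5 * σ ≤ r₁ / d) (_hc_def : c = B6.c0 1 σ ^ d)
    -- `Δ⁽²⁾` DISPLAYED: a local operator on the fine carrier ((3.137): range `r_D`, row and column sums `≤ λ`)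
    (D2 : BondL2K ℂ d (towerP L m (n + 1)) c₀ W →ₗ[ℂ] BondL2K ℂ d (towerP L m (n + 1)) c₀ W)
    {KD : UT m → UT m → ℝ} {lam rD : ℝ} (hlam : 0 ≤ lam) (hKD : ∀ y v, 0 ≤ KD y v)
    (hDloc : ∀ y v, KD y v ≠ 0 → (toB6 (torusGeom m η₀ L₀ M₀) R H).dist y v ≤ rD)
    (hDrow : ∀ y, ∑ v : UT m, KD y v ≤ lam) (hDcol : ∀ v, ∑ y : UT m, KD y v ≤ lam)
    (hD2 : HasMaj
      (supSize (toB6 (torusGeom m η₀ L₀ M₀) R H)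
        (fun y => Finset.univ.filter fun b : Bond d (towerP L m (n + 1)) =>
          blockCoord (L ^ (n + 1)) m (siteCast (towerP_eq_fineP_pow L m (n + 1)) (bpos b)) = UT.toSite m y)
        (fun b => UT.ofSite m (blockCoord (L ^ (n + 1)) m (siteCast (towerP_eq_fineP_pow L m (n + 1)) (bpos b)))) :
          BlockNorm (toB6 (torusGeom m η₀ L₀ M₀) R H) (Bond d (towerP L m (n + 1)) → W))
      (supSize (toB6 (torusGeom m η₀ L₀ M₀) R H)
        (fun y => Finset.univ.filter fun b : Bond d (towerP L m (n + 1)) =>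
          blockCoord (L ^ (n + 1)) m (siteCast (towerP_eq_fineP_pow L m (n + 1)) (bpos b)) = UT.toSite m y)
        (fun b => UT.ofSite m (blockCoord (L ^ (n + 1)) m (siteCast (towerP_eq_fineP_pow L m (n + 1)) (bpos b)))))
      (((WL2.linearEquiv ℂ ℂ (fun _ : Bond d (towerP L m (n + 1)) => c₀) :
            BondL2K ℂ d (towerP L m (n + 1)) c₀ W ≃ₗ[ℂ] (Bond d (towerP L m (n + 1)) → W)).toLinearMap ∘ₗ D2 ∘ₗ
          (WL2.linearEquiv ℂ ℂ (fun _ : Bond d (towerP L m (n + 1)) => c₀) :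
            BondL2K ℂ d (towerP L m (n + 1)) c₀ W ≃ₗ[ℂ] (Bond d (towerP L m (n + 1)) → W)).symm.toLinearMap).restrictScalars ℝ)
      KD)
    -- the derived constants, bound to their closed forms (instantiate with `rfl`), and the TWO smallnesses in `λ`
    {q BG' θP qI BI' A₀ θD BGt : ℝ}
    (hq_def : q = B * lam * Real.exp (δ / d * rD) * c) (hq : q < 1) (hBG' : BG' = B * (1 - q)⁻¹)
    (hθP : θP = B * lam * Real.exp (δ / d * rD) * BG' * c *
      ((Mφ' * Real.exp (100 * d * (d + 1) * (L : ℝ) ^ d * AQ) * Mφ * ((2 * d : ℕ) : ℝ)) * Real.exp 1 * latticeConst d 1) *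
      Real.exp ((ρ + 4 * σ) * d) * ((Mφ' * Mφ * Real.exp (50 * (d + 1) * AQ)) * Real.exp 1 * latticeConst d 1) *
      Real.exp ((ρ + 4 * σ) * d))
    (hqI : qI = A' * θP * c * c) (hqI1 : qI < 1) (hBI' : BI' = A' * (1 - qI)⁻¹)
    (hA₀ : A₀ = B * ((Mφ' * Real.exp (100 * d * (d + 1) * (L : ℝ) ^ d * AQ) * Mφ * ((2 * d : ℕ) : ℝ)) * Real.exp 1 *
      latticeConst d 1) * Real.exp δ * A' * c)
    (hθD : θD = A₀ * lam * Real.exp (ρ * rD))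
    (hBGt : BGt = BG' + ((Mφ' * Mφ * Real.exp (50 * (d + 1) * AQ)) * Real.exp 1 * latticeConst d 1) *
      ((Mφ' * Real.exp (100 * d * (d + 1) * (L : ℝ) ^ d * AQ) * Mφ * ((2 * d : ℕ) : ℝ)) * Real.exp 1 * latticeConst d 1) *
      BI' * BG' * BG' * Real.exp ((ρ + 2 * σ) * d) * Real.exp ((ρ + 2 * σ) * d) * c * c),
    ∃ (G' : (Bond d (towerP L m (n + 1)) → W) →L[ℂ] (Bond d (towerP L m (n + 1)) → W))
      (Inv' : (Bond d m → W) →L[ℂ] (Bond d m → W)),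
      -- `G′ = (Δ_{a,k}(U) − Δ⁽²⁾)⁻¹`, two-sided
      G' * (LinearMap.toContinuousLinearMap
          ((WL2.linearEquiv ℂ ℂ (fun _ : Bond d (towerP L m (n + 1)) => c₀) :
              BondL2K ℂ d (towerP L m (n + 1)) c₀ W ≃ₗ[ℂ] (Bond d (towerP L m (n + 1)) → W)).toLinearMap ∘ₗ
            laplaceAk L m n φ η U hL αU hα1 hU1 hreg τ (c₀ := c₀) (c₁ := c₁) a ∘ₗ
            (WL2.linearEquiv ℂ ℂ (fun _ : Bond d (towerP L m (n + 1)) => c₀) :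
              BondL2K ℂ d (towerP L m (n + 1)) c₀ W ≃ₗ[ℂ] (Bond d (towerP L m (n + 1)) → W)).symm.toLinearMap) -
        LinearMap.toContinuousLinearMap
          ((WL2.linearEquiv ℂ ℂ (fun _ : Bond d (towerP L m (n + 1)) => c₀) :
              BondL2K ℂ d (towerP L m (n + 1)) c₀ W ≃ₗ[ℂ] (Bond d (towerP L m (n + 1)) → W)).toLinearMap ∘ₗ D2 ∘ₗ
            (WL2.linearEquiv ℂ ℂ (fun _ : Bond d (towerP L m (n + 1)) => c₀) :
              BondL2K ℂ d (towerP L m (n + 1)) c₀ W ≃ₗ[ℂ] (Bond d (towerP L m (n + 1)) → W)).symm.toLinearMap)) = 1 ∧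
      (LinearMap.toContinuousLinearMap
          ((WL2.linearEquiv ℂ ℂ (fun _ : Bond d (towerP L m (n + 1)) => c₀) :
              BondL2K ℂ d (towerP L m (n + 1)) c₀ W ≃ₗ[ℂ] (Bond d (towerP L m (n + 1)) → W)).toLinearMap ∘ₗ
            laplaceAk L m n φ η U hL αU hα1 hU1 hreg τ (c₀ := c₀) (c₁ := c₁) a ∘ₗ
            (WL2.linearEquiv ℂ ℂ (fun _ : Bond d (towerP L m (n + 1)) => c₀) :
              BondL2K ℂ d (towerP L m (n + 1)) c₀ W ≃ₗ[ℂ] (Bond d (towerP L m (n + 1)) → W)).symm.toLinearMap) -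
        LinearMap.toContinuousLinearMap
          ((WL2.linearEquiv ℂ ℂ (fun _ : Bond d (towerP L m (n + 1)) => c₀) :
              BondL2K ℂ d (towerP L m (n + 1)) c₀ W ≃ₗ[ℂ] (Bond d (towerP L m (n + 1)) → W)).toLinearMap ∘ₗ D2 ∘ₗ
            (WL2.linearEquiv ℂ ℂ (fun _ : Bond d (towerP L m (n + 1)) => c₀) :
              BondL2K ℂ d (towerP L m (n + 1)) c₀ W ≃ₗ[ℂ] (Bond d (towerP L m (n + 1)) → W)).symm.toLinearMap)) * G' = 1 ∧
      -- `Inv′ = (Q_kG′Q_k†)⁻¹`, two-sided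
      Inv' * ((LinearMap.toContinuousLinearMap
          ((WL2.linearEquiv ℂ ℂ (fun _ : Bond d m => c₁) : BondL2K ℂ d m c₁ W ≃ₗ[ℂ] (Bond d m → W)).toLinearMap ∘ₗ
            QkW L m n φ U hL αU hα1 hU1 hreg (c₀ := c₀) (c₁ := c₁) ∘ₗ
            (WL2.linearEquiv ℂ ℂ (fun _ : Bond d (towerP L m (n + 1)) => c₀) :
              BondL2K ℂ d (towerP L m (n + 1)) c₀ W ≃ₗ[ℂ] (Bond d (towerP L m (n + 1)) → W)).symm.toLinearMap)).comp
        (G'.comp (LinearMap.toContinuousLinearMap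
          ((WL2.linearEquiv ℂ ℂ (fun _ : Bond d (towerP L m (n + 1)) => c₀) :
              BondL2K ℂ d (towerP L m (n + 1)) c₀ W ≃ₗ[ℂ] (Bond d (towerP L m (n + 1)) → W)).toLinearMap ∘ₗ
            LinearMap.adjoint (QkW L m n φ U hL αU hα1 hU1 hreg (c₀ := c₀) (c₁ := c₁)) ∘ₗ
            (WL2.linearEquiv ℂ ℂ (fun _ : Bond d m => c₁) : BondL2K ℂ d m c₁ W ≃ₗ[ℂ] (Bond d m → W)).symm.toLinearMap)))) = 1 ∧
      ((LinearMap.toContinuousLinearMap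
          ((WL2.linearEquiv ℂ ℂ (fun _ : Bond d m => c₁) : BondL2K ℂ d m c₁ W ≃ₗ[ℂ] (Bond d m → W)).toLinearMap ∘ₗ
            QkW L m n φ U hL αU hα1 hU1 hreg (c₀ := c₀) (c₁ := c₁) ∘ₗ
            (WL2.linearEquiv ℂ ℂ (fun _ : Bond d (towerP L m (n + 1)) => c₀) :
              BondL2K ℂ d (towerP L m (n + 1)) c₀ W ≃ₗ[ℂ] (Bond d (towerP L m (n + 1)) → W)).symm.toLinearMap)).comp
        (G'.comp (LinearMap.toContinuousLinearMap
          ((WL2.linearEquiv ℂ ℂ (fun _ : Bond d (towerP L m (n + 1)) => c₀) :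
              BondL2K ℂ d (towerP L m (n + 1)) c₀ W ≃ₗ[ℂ] (Bond d (towerP L m (n + 1)) → W)).toLinearMap ∘ₗ
            LinearMap.adjoint (QkW L m n φ U hL αU hα1 hU1 hreg (c₀ := c₀) (c₁ := c₁)) ∘ₗ
            (WL2.linearEquiv ℂ ℂ (fun _ : Bond d m => c₁) : BondL2K ℂ d m c₁ W ≃ₗ[ℂ] (Bond d m → W)).symm.toLinearMap)))) * Inv' = 1 ∧
      -- the (190) letter of `H₀ + G̃Δ⁽²⁾H₀`, `H₀ = H₁,k(U)` by name, `G̃ = G′ − G′Q_k†·Inv′·Q_kG′`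
      ∀ δ' : ℝ, δ' / 8 ≤ ρ →
        Ineq190
          (supSize (toB6 (torusGeom m η₀ L₀ M₀) R H)
            (fun y => Finset.univ.filter fun c : Bond d m => bpos c = UT.toSite m y)
            (fun c => UT.ofSite m (bpos c)) : BlockNorm (toB6 (torusGeom m η₀ L₀ M₀) R H) (Bond d m → W))
          (supSize (toB6 (torusGeom m η₀ L₀ M₀) R H)
            (fun y => Finset.univ.filter fun b : Bond d (towerP L m (n + 1)) =>
              blockCoord (L ^ (n + 1)) m (siteCast (towerP_eq_fineP_pow L m (n + 1)) (bpos b)) = UT.toSite m y)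
            (fun b => UT.ofSite m (blockCoord (L ^ (n + 1)) m (siteCast (towerP_eq_fineP_pow L m (n + 1)) (bpos b)))) :
              BlockNorm (toB6 (torusGeom m η₀ L₀ M₀) R H) (Bond d (towerP L m (n + 1)) → W))
          ((((WL2.linearEquiv ℂ ℂ (fun _ : Bond d (towerP L m (n + 1)) => c₀) :
                  BondL2K ℂ d (towerP L m (n + 1)) c₀ W ≃ₗ[ℂ] (Bond d (towerP L m (n + 1)) → W)).toLinearMap ∘ₗ
              H1k L m n φ η U hL αU hα1 hU1 hreg τ (c₀ := c₀) (c₁ := c₁) _hαL hpos ∘ₗ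
              (WL2.linearEquiv ℂ ℂ (fun _ : Bond d m => c₁) : BondL2K ℂ d m c₁ W ≃ₗ[ℂ] (Bond d m → W)).symm.toLinearMap).restrictScalars ℝ) +
            ((G'.restrictScalars ℝ : (Bond d (towerP L m (n + 1)) → W) →ₗ[ℝ] (Bond d (towerP L m (n + 1)) → W)) -
              ((G'.restrictScalars ℝ : (Bond d (towerP L m (n + 1)) → W) →ₗ[ℝ] (Bond d (towerP L m (n + 1)) → W)) ∘ₗ
                (((WL2.linearEquiv ℂ ℂ (fun _ : Bond d (towerP L m (n + 1)) => c₀) :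
                      BondL2K ℂ d (towerP L m (n + 1)) c₀ W ≃ₗ[ℂ] (Bond d (towerP L m (n + 1)) → W)).toLinearMap ∘ₗ
                  LinearMap.adjoint (QkW L m n φ U hL αU hα1 hU1 hreg (c₀ := c₀) (c₁ := c₁)) ∘ₗ
                  (WL2.linearEquiv ℂ ℂ (fun _ : Bond d m => c₁) : BondL2K ℂ d m c₁ W ≃ₗ[ℂ] (Bond d m → W)).symm.toLinearMap).restrictScalars ℝ)) ∘ₗ
              (Inv'.restrictScalars ℝ : (Bond d m → W) →ₗ[ℝ] (Bond d m → W)) ∘ₗ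
              ((((WL2.linearEquiv ℂ ℂ (fun _ : Bond d m => c₁) : BondL2K ℂ d m c₁ W ≃ₗ[ℂ] (Bond d m → W)).toLinearMap ∘ₗ
                  QkW L m n φ U hL αU hα1 hU1 hreg (c₀ := c₀) (c₁ := c₁) ∘ₗ
                  (WL2.linearEquiv ℂ ℂ (fun _ : Bond d (towerP L m (n + 1)) => c₀) :
                    BondL2K ℂ d (towerP L m (n + 1)) c₀ W ≃ₗ[ℂ] (Bond d (towerP L m (n + 1)) → W)).symm.toLinearMap).restrictScalars ℝ) ∘ₗ
                (G'.restrictScalars ℝ : (Bond d (towerP L m (n + 1)) → W) →ₗ[ℝ] (Bond d (towerP L m (n + 1)) → W)))) ∘ₗ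
            ((((WL2.linearEquiv ℂ ℂ (fun _ : Bond d (towerP L m (n + 1)) => c₀) :
                    BondL2K ℂ d (towerP L m (n + 1)) c₀ W ≃ₗ[ℂ] (Bond d (towerP L m (n + 1)) → W)).toLinearMap ∘ₗ D2 ∘ₗ
                (WL2.linearEquiv ℂ ℂ (fun _ : Bond d (towerP L m (n + 1)) => c₀) :
                  BondL2K ℂ d (towerP L m (n + 1)) c₀ W ≃ₗ[ℂ] (Bond d (towerP L m (n + 1)) → W)).symm.toLinearMap).restrictScalars ℝ) ∘ₗ
              (((WL2.linearEquiv ℂ ℂ (fun _ : Bond d (towerP L m (n + 1)) => c₀) :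
                    BondL2K ℂ d (towerP L m (n + 1)) c₀ W ≃ₗ[ℂ] (Bond d (towerP L m (n + 1)) → W)).toLinearMap ∘ₗ
                H1k L m n φ η U hL αU hα1 hU1 hreg τ (c₀ := c₀) (c₁ := c₁) _hαL hpos ∘ₗ
                (WL2.linearEquiv ℂ ℂ (fun _ : Bond d m => c₁) : BondL2K ℂ d m c₁ W ≃ₗ[ℂ] (Bond d m → W)).symm.toLinearMap).restrictScalars ℝ)))
          (A₀ + BGt * θD * c) δ' := by
  obtain ⟨α₁, B, δ, hα₁, hB, hδ, HG⟩ := exists_hasMaj_G1k_tower_sup hd L hL hL3 φ hMφ hMφ' hφ hφ' hstar ha ha' hϱ0 hϱ1 τ hτ hCτ hτm hMτ hρw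
    hτ₁ hτ₂ hφτ AQ
  obtain ⟨α₀, r₁, A', hα₀, hr₁, hA', HI⟩ := exists_hasMaj_Kinv_tower_sup hd L hL hL3 φ hMφ hMφ' hφ hφ' hstar ha ha' hϱ0 hϱ1 τ hτ hCτ hτm hMτ hρw
    hτ₁ hτ₂ hφτ
  refine ⟨min α₁ α₀, B, δ, A', r₁, lt_min hα₁ hα₀, hB, hδ, hA', hr₁, ?_⟩
  intro n η hηL c₀ c₁ _ _ hw hρ m _ hm U αU hα0 hα1 hαL hU1 hreg εU hεU hUε hLb α hα hαle hUst hUb hUη hpl hUgrad hRlev hεg hAQ hpos' hpos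
    η₀ L₀ M₀ R H ρ σ c hσ hρ0 hρ₁ hρI hc_def D2 KD lam rD hlam hKD hDloc hDrow hDcol hD2 q BG' θP qI BI' A₀ θD BGt hq_def hq hBG' hθP hqI hqI1 hBI'
    hA₀ hθD hBGt
  -- the two analytic letters at this height, BY NAME
  have hG0 := HG n η hηL c₀ c₁ hw hρ m hm U αU hα0 hα1 hU1 hreg εU hεU hUε hLb α hα (hαle.trans (min_le_left _ _)) hUst hUb hUη hpl hUgrad
    hRlev hεg hAQ hpos' hpos η₀ L₀ M₀ R H
  have hQ := B9Eq326OperatorTower.QkW_surjective L m n φ U hL αU hα1 hU1 hreg (c₀ := c₀) (c₁ := c₁) hαL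
  have hInv0 := HI n η hηL c₀ c₁ hw hρ m hm U αU hα0 hα1 hαL hU1 hreg εU hεU hUε hLb α hα (hαle.trans (min_le_right _ _)) hUst hUb hUη hpl
    hεg hpos hQ η₀ L₀ M₀ R H
  -- the free row sum
  have hrow : RowSum (toB6 (torusGeom m η₀ L₀ M₀) R H) σ c := by rw [hc_def]; exact rowSum_blocks η₀ L₀ M₀ R H hσ
  have hc : 0 ≤ c := by
    rw [hc_def]
    refine pow_nonneg ?_ _
    unfold B6.c0
    exact tsum_nonneg fun z => (Real.exp_pos _).le
  exact exists_ineq190_origin_tower_sup L m n φ η U hL αU hα0 hα1 hU1 hreg hMφ hφ hMφ' hφ' τ hpos hQ η₀ L₀ M₀ R H hd hm hw hAQ hB hδ.le hA' hr₁.le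
    hrow hc hσ.le hρ0 hρ₁ hρI hG0 hInv0 D2 hlam hKD hDloc hDrow hDcol hD2 hq_def hq hBG' hθP hqI hqI1 hBI' hA₀ hθD hBGt

end Tower

end Literature.MathematicalPhysics.QuantumFieldTheory.Balaban1983to89.Beta.RemainderOriginTowerClosed

end
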